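import Summits.ResolutionOfSingularities.ResolutionOfSingularities.Theorems.WeightedInvariantELadderAssembly
import Summits.ResolutionOfSingularities.ResolutionOfSingularities.Theorems.WeightedInvariantELadderOneInvSucc
import Summits.ResolutionOfSingularities.ResolutionOfSingularities.Theorems.WeightedInvariantELadderOneCentreUnconditional
import HarnessLib

/-!
# Sanity corollary of the abstract ladder assembly: rung `e = 1` is ONE instance of `ELadder.ladder_assembly`

Route `ResolutionOfSingularities/WeightedInvariant`, door crux `HypersurfaceCentreConstruction`
(stmt-ResolutionOfSingularities-19897) — OURS, helper (counted 0); ORDER (o54) of res-L1-w43-plan-1 (HOME/STATUS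
2026-08-27T14:12:08Z), «SANITY COROLLARY: re-derive `e1_assembly_unconditional` as `ladder_assembly Stage.Inv' Stage.mu
(fun S R' => ∀ b, R'.πPlus b ∈ S.maxSing → idealOrder … < …) exists_isAdmissibleCentre stub_e1_inv_succ` (one `exact`,
proves the abstraction is the right one)» + AMENDMENT 14:13:09Z (e = 1 corollary: `Good S R := R.support = singImage
S.i.ker ∧ ∀ R', R'.ideal = R.piece → ∀ b, …`), hand res-L1-w43-stub-3.

* **`ELadder.e1_resolvable_of_ladder_assembly`** — `∀ S : Stage k, S.Inv' → S.toPair.Resolvable`, obtained as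
  `ELadder.ladder_assembly_of_support_eq Stage.Inv' Stage.mu Drop₁ exists_isAdmissibleCentre stub_e1_inv_succ S hInv` with
  `Drop₁ S R' := ∀ b, R'.πPlus b ∈ S.maxSing → idealOrder (R'.strictTransformPlus S.i.ker) b < idealOrder S.i.ker (R'.πPlus b)`
  (the `hdrop` line of `ELadderOne.stub_e1_inv_succ`, p519393, written inline; the
  `Good S R := R.support = singImage S.i.ker ∧ ∀ R', R'.ideal = R.piece → Drop₁ S R'` instance of
  `ELadder.ladder_assembly`; the tree's unconditional centre `ELadderOne.exists_isAdmissibleCentre` and successor step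
  `ELadderOne.stub_e1_inv_succ`, p519393, are fed VERBATIM — no adapter), i.e. the content of
  `ELadderOne.e1_assembly_unconditional` recovered from the abstraction;
* (the rung itself, `AdmissiblyResolvableDim p 1`, is NOT re-derived here: it is the landed
  `ELadderOne.admissiblyResolvableDim_one`, p531513 — `stub_e1_base'` + the line above; restating it would duplicate a tree
  declaration.)

[OURS · L1 W4.3 · door tier E2 · pure port]  Theorems about OUR typed objects; NOT a statement of H. Hironaka's
manuscript [claim: Hironaka2017, status: under-review].  AI-written; gate-checked ≠ expert-reviewed.
[cite: AbramovichQuekSchober2025, Thm 1.1, Thm 1.3; Wlodarczyk2022, §2.3.3]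
-/

noncomputable section

set_option linter.dupNamespace false -- mandated namespace of this single-conjunct summit

open CategoryTheory AlgebraicGeometry TopologicalSpace IsLocalRing
open Literature.AlgebraicGeometry.Resolution
open Summit.ResolutionOfSingularities.ResolutionOfSingularities.Theorems
open Summit.ResolutionOfSingularities.ResolutionOfSingularities.Theorems.ELadderOne

namespace Summit.ResolutionOfSingularities.ResolutionOfSingularities.Theorems.ELadder

variable {k : Type} [Field k]

/-- **Rung `e = 1` recovered from the abstract ladder assembly**: every stage with `Inv'` has a resolvable hypersurface
pair — `ELadder.ladder_assembly_of_support_eq` at `(Stage.Inv', Stage.mu, order-drop line)` fed with the tree's unconditional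
centre step `ELadderOne.exists_isAdmissibleCentre` and successor step `ELadderOne.stub_e1_inv_succ`, both verbatim.
This is the content of `ELadderOne.e1_assembly_unconditional`; it certifies that the abstraction has the right binders.
[cite: AbramovichQuekSchober2025, Thm 1.1, Thm 1.3] -/
theorem e1_resolvable_of_ladder_assembly [PerfectField k] : ∀ S : Stage k, S.Inv' → S.toPair.Resolvable :=
  fun S hInv => ladder_assembly_of_support_eq Stage.Inv' Stage.mu
    (fun S R' => ∀ b : ↥R'.plus, R'.πPlus b ∈ S.maxSing →
      idealOrder (R'.strictTransformPlus S.i.ker) b < idealOrder S.i.ker (R'.πPlus b))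
    exists_isAdmissibleCentre stub_e1_inv_succ S hInv

end Summit.ResolutionOfSingularities.ResolutionOfSingularities.Theorems.ELadder

end
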